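import Summits.CriticalPhenomena.PercolationContinuityZ3.Theorems.PercLowPointHalfSpaceQuantitativeBGNFloorTransfer
import Summits.CriticalPhenomena.PercolationContinuityZ3.Theorems.PercLowPointHalfSpaceQuantitativeBGNFloorSuccZero
import HarnessLib

/-!
# `QuantitativeBGN` (stmt-CriticalPhenomena-0913), line `microscopic-floor-doubling-gain` — exactness of the Russo cut

Crux `Summit.CriticalPhenomena.PercolationContinuityZ3.Theses.PercLowPointHalfSpace.QuantitativeBGN`, line
`microscopic-floor-doubling-gain` (lead c2). The line cuts the uniform floor-doubling gain `(G)` into the exact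
floor-pivotality form `Σ_{j∈(h,2h]} I_j ≥ κ'`, `I_j = floorLogGain r j = ∫₀¹ p_c g_j/f_j`. This file certifies,
kernel-checked, that the cut is EXACT on the window: for `j + 1 < r`,

  `I_{j+1} = log γ_r(j+1) − log γ_r(j)`  (`floorLogGain_succ_eq_log_sub`),

because Russo's formula holds with equality (`FloorRussoCalc.integral_div_eq_log_sub` on the landed
`stub_floorDeriv`) and, with the floor deleted, the arm from height `j+1` IS the arm from height `j`
(`armProbFloor_succ_zero`, landed p125240: floor vertices are pendant). Hence the dyadic sums telescope,
`Σ_{j∈(h,2h]} I_j = log γ_r(2h) − log γ_r(h)` for `2h < r` (`sum_floorLogGain_eq_log_sub`), and the line's one open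
stub `stub_pivotalFloorDensity` is EQUIVALENT to the uniform gain `(G)` (`pivotalFloorDensity_of_floorGain` here;
the converse is `FloorTransfer.floorGain_of_pivotalFloorDensity`, p124804): the Russo dress adds and loses nothing —
the open content of the line is exactly `(G)`, a uniform-in-`r`, local-in-depth gain for one critical half-space arm.
-/

noncomputable section

namespace Summit.CriticalPhenomena.PercolationContinuityZ3.Theorems

open MeasureTheory Literature.Probability.Percolation Literature.Probability.LatticeModels
open FloorDoubling

namespace FloorExact

/-- `γ_r(h) > 0` for `r ≥ 1` (landed depth monotonicity + the disprover's lower bound `γ_r(0) ≥ 1/(588 r²)`).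
[folklore] -/
theorem gammaR_pos {r : ℕ} (hr : 1 ≤ r) (h : ℕ) : 0 < gammaR r h := by
  have hmon : Monotone (gammaR r) := monotone_nat_of_le_succ fun k => stub_depthMono r k
  refine lt_of_lt_of_le ?_ (hmon (Nat.zero_le h))
  obtain ⟨n, rfl⟩ : ∃ n, r = n + 1 := ⟨r - 1, by omega⟩
  have hlow := Theorems.QuantitativeBGN.Negative.armH_lower_bound n
  rw [gammaR_zero_eq_armH]
  exact lt_of_lt_of_le (by positivity) hlow

/-- **Russo with equality**: `I_j = log f_j(1) − log f_j(0) = log γ_r(j) − log f_j(0)` whenever `f_j(0) > 0`.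
[folklore] -/
theorem floorLogGain_eq_log_sub {r j : ℕ} (h0 : 0 < armProbFloor r j 0) :
    floorLogGain r j = Real.log (gammaR r j) - Real.log (armProbFloor r j 0) := by
  obtain ⟨hone, hcontf, hcontg, hderiv⟩ := stub_floorDeriv r j
  have hpc0 : (0 : ℝ) ≤ (criticalProbI 3 : ℝ) := (criticalProbI 3).2.1
  have hf0 : armProbFloor r j (Set.projIcc (0 : ℝ) 1 zero_le_one 0) = armProbFloor r j 0 := by
    simp only [Set.projIcc_left]; rfl
  have hf1 : armProbFloor r j (Set.projIcc (0 : ℝ) 1 zero_le_one 1) = gammaR r j := by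
    simp only [Set.projIcc_right]; exact hone
  have key := FloorRussoCalc.integral_div_eq_log_sub (f := fun t => armProbFloor r j (Set.projIcc (0 : ℝ) 1 zero_le_one t))
    (g := fun t => (criticalProbI 3 : ℝ) * pivotalFloorSum r j (Set.projIcc (0 : ℝ) 1 zero_le_one t))
    hcontf (continuous_const.mul hcontg) (fun t => mul_nonneg hpc0 (pivotalFloorSum_nonneg _ _ _)) hderiv
    (by rw [hf0]; exact h0)
  simp only [hf0, hf1] at key
  exact key

/-- **The cut is exact**: `I_{j+1} = log γ_r(j+1) − log γ_r(j)` for `j + 1 < r`. [folklore] -/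
theorem floorLogGain_succ_eq_log_sub {r j : ℕ} (hjr : j + 1 < r) :
    floorLogGain r (j + 1) = Real.log (gammaR r (j + 1)) - Real.log (gammaR r j) := by
  have hfz : armProbFloor r (j + 1) 0 = gammaR r j := armProbFloor_succ_zero r j (by omega)
  have hpos : 0 < armProbFloor r (j + 1) 0 := by rw [hfz]; exact gammaR_pos (by omega) j
  rw [floorLogGain_eq_log_sub hpos, hfz]

/-- **Telescoping**: `Σ_{j ∈ (h, h+n]} I_j = log γ_r(h+n) − log γ_r(h)` for `h + n < r`. [folklore] -/
theorem sum_floorLogGain_eq_log_sub' (r h : ℕ) : ∀ n : ℕ, h + n < r →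
    ∑ j ∈ Finset.Ioc h (h + n), floorLogGain r j = Real.log (gammaR r (h + n)) - Real.log (gammaR r h) := by
  intro n
  induction n with
  | zero => intro _; simp
  | succ n ih =>
    intro hn
    rw [← add_assoc, Finset.sum_Ioc_succ_top (by omega : h ≤ h + n), ih (by omega),
      floorLogGain_succ_eq_log_sub (by omega)]
    ring

/-- **Dyadic block**: `Σ_{j ∈ (h, 2h]} I_j = log γ_r(2h) − log γ_r(h)` for `2h < r`. [folklore] -/
theorem sum_floorLogGain_eq_log_sub {r h : ℕ} (h2 : 2 * h < r) :
    ∑ j ∈ Finset.Ioc h (2 * h), floorLogGain r j = Real.log (gammaR r (2 * h)) - Real.log (gammaR r h) := by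
  have := sum_floorLogGain_eq_log_sub' r h h (by omega)
  rwa [← two_mul] at this

/-- Inside the window `2h ≤ r^δ` with `δ ≤ 1`, `h ≥ 1`: `2h < r` … unless `r ≤ 1`, which the window excludes.
[folklore] -/
theorem two_mul_lt_of_window {δ : ℝ} (hδ : 0 < δ) (hδ1 : δ < 1) {r h : ℕ} (hh : 1 ≤ h)
    (hwin : ((2 * h : ℕ) : ℝ) ≤ (r : ℝ) ^ δ) : 2 * h < r := by
  have h2h : (2 : ℝ) ≤ ((2 * h : ℕ) : ℝ) := by exact_mod_cast (by omega : 2 ≤ 2 * h)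
  have hr2 : (2 : ℝ) ≤ (r : ℝ) ^ δ := h2h.trans hwin
  have hr1 : (1 : ℝ) < r := by
    by_contra hle
    push Not at hle
    have : (r : ℝ) ^ δ ≤ 1 := Real.rpow_le_one (Nat.cast_nonneg r) hle hδ.le
    linarith
  have hlt : (r : ℝ) ^ δ < (r : ℝ) ^ (1 : ℝ) := Real.rpow_lt_rpow_of_exponent_lt hr1 hδ1
  rw [Real.rpow_one] at hlt
  exact_mod_cast lt_of_le_of_lt hwin hlt

end FloorExact

/-- **EQUIVALENCE CERTIFICATE (uniform gain ⟹ pivotal-floor density).** The uniform microscopic floor-doubling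
gain `(G)` implies the line's open stub `stub_pivotalFloorDensity` (with `κ' = log(1+κ)`, window exponent
`min δ 1/2`); together with the landed converse `FloorTransfer.floorGain_of_pivotalFloorDensity` the Russo cut is
exact: the open content of the line is precisely `(G)`. [folklore] -/
theorem pivotalFloorDensity_of_floorGain : (∃ κ δ : ℝ, ∃ h₀ : ℕ, 0 < κ ∧ 0 < δ ∧ 1 ≤ h₀ ∧ ∀ r h : ℕ, h₀ ≤ h → ((2 * h : ℕ) : ℝ) ≤ (r : ℝ) ^ δ → (1 + κ) * gammaR r h ≤ gammaR r (2 * h)) → (∃ κ' δ : ℝ, ∃ h₀ : ℕ, 0 < κ' ∧ 0 < δ ∧ 1 ≤ h₀ ∧ ∀ r h : ℕ, h₀ ≤ h → ((2 * h : ℕ) : ℝ) ≤ (r : ℝ) ^ δ → κ' ≤ ∑ j ∈ Finset.Ioc h (2 * h), floorLogGain r j) := by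
  rintro ⟨κ, δ, h₀, hκ, hδ, hh₀, hG⟩
  set δ' : ℝ := min δ (1 / 2) with hδ'
  have hδ'pos : 0 < δ' := lt_min hδ (by norm_num)
  have hδ'lt : δ' < 1 := (min_le_right _ _).trans_lt (by norm_num)
  have hδ'le : δ' ≤ δ := min_le_left _ _
  refine ⟨Real.log (1 + κ), δ', h₀, Real.log_pos (by linarith), hδ'pos, hh₀, fun r h hh hwin => ?_⟩
  have h1 : 1 ≤ h := hh₀.trans hh
  have h2r : 2 * h < r := FloorExact.two_mul_lt_of_window hδ'pos hδ'lt h1 hwin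
  have hr1 : 1 ≤ r := by omega
  -- the smaller window lies inside the window of (G)
  have hwin' : ((2 * h : ℕ) : ℝ) ≤ (r : ℝ) ^ δ := by
    refine hwin.trans ?_
    exact Real.rpow_le_rpow_of_exponent_le (by exact_mod_cast hr1) hδ'le
  have hgain := hG r h hh hwin'
  have hγh : 0 < gammaR r h := FloorExact.gammaR_pos hr1 h
  have hγ2h : 0 < gammaR r (2 * h) := FloorExact.gammaR_pos hr1 (2 * h)
  rw [FloorExact.sum_floorLogGain_eq_log_sub h2r, ← Real.log_div hγ2h.ne' hγh.ne']
  refine Real.log_le_log (by linarith) ?_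
  rwa [le_div_iff₀ hγh]

end Summit.CriticalPhenomena.PercolationContinuityZ3.Theorems

end
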